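import Summits.QuantumFields.QCD.Theses.GapBuysCauchyRate
import Literature.MathematicalPhysics.QuantumFieldTheory.QCDTimeReflectionProofs

/-!
# Stub `stub_boltzmannReflect` (W7a) of line `birth` for crux `GapBuysCauchyRate.LadderCauchyRate`
(item stmt-QuantumFields-17307, route route-QuantumFields-GapBuysCauchyRate, sub-problem QCD)

What is proved: for every flavour number `N_f`, EVERY torus side `L ≥ 1`, every `SU(3)` gauge field
`U` on the four-torus of side `L` and all bare quark masses `mq`, the time-PERIODIC quark Boltzmann
factor `e^{−ψ̄ D(U) ψ}` (`fermiBoltzmann U mq`, with `D(U) = ⊕_f D_W(U, m_f, r = 1)` the tree's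
Wilson–Dirac matrix `wilsonDirac` in the fundamental representation) is reflection symmetric under
the Osterwalder–Seiler/Lüscher site reflection `Θ_T = torusTheta` of the torus quark Grassmann
algebra: `Θ_T e^{−ψ̄ D(U) ψ} = e^{−ψ̄ D(Θ'U) ψ}` with `Θ' = GaugeConfig.negReflect`
(Montvay–Münster (4.95)/(4.106), `ΘS = S ∘ Θ'`, for the whole torus action at once).

How.  The sign-free clone of the tree's antiperiodic argument `torusTheta_fermiBoltzmannAP` (which
needs an odd torus only because of its antiperiodic link layer `apLinkSign`): `Θ_T` passes through
the exponential (`torusTheta_grassmannExp`; the quadratic action is nilpotent,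
`isNilpotent_quadratic`) and through the quadratic form (`torusTheta_quadratic`:
`Θ_T (ψ̄Aψ) = ψ̄A^Θψ` with `A^Θ = thetaMatrix A`, and `thetaMatrix_neg`), so everything reduces to
`(D(U))^Θ = D(Θ'U)` (`thetaMatrix_diracMatrix`).  Blockwise in spin this reads
`γ₀ [W(U)_{(θy,b),(θx,a)}]ᴴ γ₀ = W(Θ'U)_{(x,a),(y,b)}` (`gamma_conj_wilsonDiracBlock`), proved from
the normal form of the `4 × 4` spin block (`wilsonDiracBlock_eq`: mass `· 1` minus half the sum
over directions of forward hop `· (r − γ_μ)` plus backward hop `· (r + γ_μ)`), the tree's spin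
algebra `γ₀ 1ᴴ γ₀ = 1`, `γ₀ (r ∓ γ_μ)ᴴ γ₀ = r ± γ_μ` (`μ ≠ 0`), `γ₀ (r ∓ γ₀)ᴴ γ₀ = r ∓ γ₀`
(`gamma_conj_one`, `gamma_conj_sub_of_ne`, `gamma_conj_add_of_ne`, `gamma_conj_sub_zero`,
`gamma_conj_add_zero`), the reality of the mass coefficient (`star_massCoeff`), and the behaviour
of the hop coefficients under `conj ∘ θ`: a spatial forward hop of `U` becomes a backward hop of
`Θ'U` and vice versa (`Θ'U = U ∘ θ` on spatial links, `conj g_{ba} = (g⁻¹)_{ab}` on `SU(3)`;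
`star_periodicHopF_of_ne`, `star_periodicHopB_of_ne`), while a temporal forward (backward) hop
stays a forward (backward) hop of `Θ'U`, because `Θ'` reverses AND inverts the temporal link
(`star_periodicHopF_zero`, `star_periodicHopB_zero`).  No parity of `L` is needed: the periodic
action has no seam.  Sources: Montvay–Münster 1994 §4.2.3 (4.92), (4.95), (4.99), (4.106);
Osterwalder–Seiler 1978 §2; Lüscher 1977.

Pure theorem file (no definitions): the registered stub signature, proved in tree vocabulary.
-/

noncomputable section

namespace Summit.QuantumFields.QCD.Cruxes.LadderCauchyRate.Birth

open scoped BigOperators Matrix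
open MeasureTheory Filter
open Literature.MathematicalPhysics.AQFT Literature.Probability.LatticeModels
  Literature.MathematicalPhysics.QuantumLattice Literature.MathematicalPhysics.QuantumFieldTheory
open Summit.QuantumFields.QCD.Theses.GapBuysCauchyRate

/-! ### Reflection symmetry of the periodic Wilson–Dirac spin blocks (every torus side) -/

section DiracReflection

variable {L : ℕ}

/-- **Normal form of the spin block of the periodic Wilson–Dirac matrix** between `(x, a)` and
`(y, b)`: mass times the identity minus half the sum over directions of (forward hop coefficient
`U(x,μ)_{ab} δ_{y,x+ê_μ}`) `· (r − γ_μ)` + (backward hop coefficient `U(y,μ)⁻¹_{ab} δ_{x,y+ê_μ}`)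
`· (r + γ_μ)` — the `apLinkSign`-free twin of the tree's `wBlock_eq`. -/
private theorem wilsonDiracBlock_eq (U : GaugeConfig 4 L (Matrix.specialUnitaryGroup (Fin 3) ℂ))
    (m r : ℝ) (x : TorusSite 4 L) (a : Fin 3) (y : TorusSite 4 L) (b : Fin 3) :
    (Matrix.of fun α β => wilsonDirac (fundamentalRep (Fin 3)) U m r (x, a, α) (y, b, β)) =
      (if x = y ∧ a = b then ((m + 4 * r : ℝ) : ℂ) else 0) • (1 : Matrix (Fin 4) (Fin 4) ℂ) -
        (1 / 2 : ℂ) • ∑ μ : Fin 4,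
          ((if y = Site.shift x μ then (U (x, μ) : Matrix (Fin 3) (Fin 3) ℂ) a b else 0) •
              ((r : ℂ) • (1 : Matrix (Fin 4) (Fin 4) ℂ) - euclideanGamma μ) +
            (if x = Site.shift y μ then
                (((U (y, μ))⁻¹ : Matrix.specialUnitaryGroup (Fin 3) ℂ) :
                  Matrix (Fin 3) (Fin 3) ℂ) a b
              else 0) •
              ((r : ℂ) • (1 : Matrix (Fin 4) (Fin 4) ℂ) + euclideanGamma μ)) := by
  ext α β
  simp only [Matrix.of_apply, wilsonDirac, Matrix.sub_apply, Matrix.smul_apply, Matrix.sum_apply,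
    Matrix.add_apply, smul_eq_mul, fundamentalRep_apply]
  congr 1
  · rw [Matrix.one_apply]
    by_cases h : x = y ∧ a = b
    · rw [if_pos h]
      by_cases hαβ : α = β
      · rw [if_pos hαβ, mul_one, if_pos]
        rw [h.1, h.2, hαβ]
      · rw [if_neg hαβ, mul_zero, if_neg]
        intro hpq
        exact hαβ (congrArg (fun p => p.2.2) hpq)
    · rw [if_neg h, zero_mul, if_neg]
      intro hpq
      exact h ⟨congrArg Prod.fst hpq, congrArg (fun p => p.2.1) hpq⟩
  · congr 1
    refine Finset.sum_congr rfl fun μ _ => ?_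
    congr 1
    · split_ifs <;> ring
    · split_ifs <;> ring

/-- Spatial forward hop coefficient under `conj ∘ θ`: it becomes the backward hop coefficient of
the reflected field (`Θ'U = U ∘ θ` on spatial links, `conj g_{ba} = (g⁻¹)_{ab}` on `SU(3)`). -/
private theorem star_periodicHopF_of_ne (U : GaugeConfig 4 L (Matrix.specialUnitaryGroup (Fin 3) ℂ))
    {μ : Fin 4} (hμ : μ ≠ 0) (x y : TorusSite 4 L) (a b : Fin 3) :
    star (if Site.negReflect x = Site.shift (Site.negReflect y) μ then
        (U (Site.negReflect y, μ) : Matrix (Fin 3) (Fin 3) ℂ) b a else 0) =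
      if x = Site.shift y μ then
        (((U.negReflect (y, μ))⁻¹ : Matrix.specialUnitaryGroup (Fin 3) ℂ) :
          Matrix (Fin 3) (Fin 3) ℂ) a b
        else 0 := by
  by_cases h : x = Site.shift y μ
  · rw [if_pos ((negReflect_eq_shift_negReflect_iff_of_ne hμ x y).2 h), if_pos h,
      star_specialUnitary_apply, GaugeConfig.negReflect_apply_of_ne _ _ hμ]
  · rw [if_neg (fun h' => h ((negReflect_eq_shift_negReflect_iff_of_ne hμ x y).1 h')), if_neg h,
      star_zero]

/-- Spatial backward hop coefficient under `conj ∘ θ`: it becomes the forward hop coefficient of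
the reflected field (`conj (g⁻¹)_{ba} = g_{ab}` on `SU(3)`). -/
private theorem star_periodicHopB_of_ne (U : GaugeConfig 4 L (Matrix.specialUnitaryGroup (Fin 3) ℂ))
    {μ : Fin 4} (hμ : μ ≠ 0) (x y : TorusSite 4 L) (a b : Fin 3) :
    star (if Site.negReflect y = Site.shift (Site.negReflect x) μ then
        (((U (Site.negReflect x, μ))⁻¹ : Matrix.specialUnitaryGroup (Fin 3) ℂ) :
          Matrix (Fin 3) (Fin 3) ℂ) b a else 0) =
      if y = Site.shift x μ then (U.negReflect (x, μ) : Matrix (Fin 3) (Fin 3) ℂ) a b else 0 := by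
  by_cases h : y = Site.shift x μ
  · rw [if_pos ((negReflect_eq_shift_negReflect_iff_of_ne hμ y x).2 h), if_pos h,
      star_specialUnitary_inv_apply, GaugeConfig.negReflect_apply_of_ne _ _ hμ]
  · rw [if_neg (fun h' => h ((negReflect_eq_shift_negReflect_iff_of_ne hμ y x).1 h')), if_neg h,
      star_zero]

/-- Temporal forward hop coefficient under `conj ∘ θ`: it stays the forward hop coefficient, of
the reflected field (the temporal link is reversed AND inverted by `Θ'`; no boundary layer, hence
no parity hypothesis on `L`). -/
private theorem star_periodicHopF_zero (U : GaugeConfig 4 L (Matrix.specialUnitaryGroup (Fin 3) ℂ))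
    (x y : TorusSite 4 L) (a b : Fin 3) :
    star (if Site.negReflect x = Site.shift (Site.negReflect y) 0 then
        (U (Site.negReflect y, 0) : Matrix (Fin 3) (Fin 3) ℂ) b a else 0) =
      if y = Site.shift x 0 then (U.negReflect (x, 0) : Matrix (Fin 3) (Fin 3) ℂ) a b else 0 := by
  by_cases h : y = Site.shift x 0
  · rw [if_pos ((negReflect_eq_shift_negReflect_iff_zero x y).2 h), if_pos h,
      star_specialUnitary_apply, GaugeConfig.negReflect_apply_zero, h]
  · rw [if_neg (fun h' => h ((negReflect_eq_shift_negReflect_iff_zero x y).1 h')), if_neg h,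
      star_zero]

/-- Temporal backward hop coefficient under `conj ∘ θ`: it stays the backward hop coefficient, of
the reflected field. -/
private theorem star_periodicHopB_zero (U : GaugeConfig 4 L (Matrix.specialUnitaryGroup (Fin 3) ℂ))
    (x y : TorusSite 4 L) (a b : Fin 3) :
    star (if Site.negReflect y = Site.shift (Site.negReflect x) 0 then
        (((U (Site.negReflect x, 0))⁻¹ : Matrix.specialUnitaryGroup (Fin 3) ℂ) :
          Matrix (Fin 3) (Fin 3) ℂ) b a else 0) =
      if x = Site.shift y 0 then
        (((U.negReflect (y, 0))⁻¹ : Matrix.specialUnitaryGroup (Fin 3) ℂ) :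
          Matrix (Fin 3) (Fin 3) ℂ) a b
        else 0 := by
  by_cases h : x = Site.shift y 0
  · rw [if_pos ((negReflect_eq_shift_negReflect_iff_zero y x).2 h), if_pos h,
      star_specialUnitary_inv_apply, GaugeConfig.negReflect_apply_zero, inv_inv, h]
  · rw [if_neg (fun h' => h ((negReflect_eq_shift_negReflect_iff_zero y x).1 h')), if_neg h,
      star_zero]

/-- **Reflection symmetry of the periodic Wilson–Dirac spin blocks** (Montvay–Münster (4.95):
`ΘS₊ = S₋`, here for the whole torus at once and every side `L`):
`γ₀ [W(U)_{(θy,b),(θx,a)}]ᴴ γ₀ = W(Θ'U)_{(x,a),(y,b)}`. -/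
private theorem gamma_conj_wilsonDiracBlock
    (U : GaugeConfig 4 L (Matrix.specialUnitaryGroup (Fin 3) ℂ)) (m r : ℝ) (x y : TorusSite 4 L)
    (a b : Fin 3) :
    euclideanGamma 0 *
          (Matrix.of fun α β => wilsonDirac (fundamentalRep (Fin 3)) U m r
            (Site.negReflect y, b, α) (Site.negReflect x, a, β))ᴴ * euclideanGamma 0 =
      Matrix.of fun α β =>
        wilsonDirac (fundamentalRep (Fin 3)) U.negReflect m r (x, a, α) (y, b, β) := by
  rw [wilsonDiracBlock_eq, wilsonDiracBlock_eq, Matrix.conjTranspose_sub,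
    Matrix.conjTranspose_smul, Matrix.conjTranspose_smul, Matrix.conjTranspose_sum, Matrix.mul_sub,
    Matrix.sub_mul, Matrix.mul_smul, Matrix.smul_mul, Matrix.mul_smul, Matrix.smul_mul,
    Matrix.mul_sum, Matrix.sum_mul, gamma_conj_one, star_massCoeff]
  congr 2
  · rw [show star (1 / 2 : ℂ) = 1 / 2 by simp]
  · refine Finset.sum_congr rfl fun μ _ => ?_
    rw [Matrix.conjTranspose_add, Matrix.conjTranspose_smul, Matrix.conjTranspose_smul,
      Matrix.mul_add, Matrix.add_mul, Matrix.mul_smul, Matrix.smul_mul, Matrix.mul_smul,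
      Matrix.smul_mul]
    by_cases hμ : μ = 0
    · subst hμ
      rw [gamma_conj_sub_zero, gamma_conj_add_zero, star_periodicHopF_zero,
        star_periodicHopB_zero]
    · rw [gamma_conj_sub_of_ne r hμ, gamma_conj_add_of_ne r hμ, star_periodicHopF_of_ne U hμ,
        star_periodicHopB_of_ne U hμ, add_comm]

end DiracReflection

/-! ### `Θ_T` of the periodic quark Boltzmann factor -/

section Boltzmann

variable {Nf L : ℕ} [NeZero L]

/-- Entries of the flavour-diagonal periodic Dirac matrix at enumerated quark variables. -/
private theorem diracMatrix_quarkEquiv_quarkEquiv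
    (U : GaugeConfig 4 L (Matrix.specialUnitaryGroup (Fin 3) ℂ)) (mq : Fin Nf → ℝ)
    (v w : QuarkVar Nf L) :
    diracMatrix U mq (quarkEquiv v) (quarkEquiv w) =
      if v.1 = w.1 then wilsonDirac (fundamentalRep (Fin 3)) U (mq v.1) 1 v.2 w.2 else 0 := by
  simp only [diracMatrix, Matrix.reindex_apply, Matrix.submatrix_apply, Equiv.symm_apply_apply,
    Matrix.of_apply]

/-- **The `Θ`-conjugate of the periodic QCD Dirac matrix is the Dirac matrix of the reflected
gauge field** (every torus side): `(D(U))^Θ = D(Θ'U)` — reflection symmetry (4.95)/(4.106) of the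
time-periodic Wilson quark action. -/
theorem thetaMatrix_diracMatrix (U : GaugeConfig 4 L (Matrix.specialUnitaryGroup (Fin 3) ℂ))
    (mq : Fin Nf → ℝ) : thetaMatrix (diracMatrix U mq) = diracMatrix U.negReflect mq := by
  ext p q
  obtain ⟨⟨f, x, a, σ⟩, rfl⟩ := quarkEquiv.surjective p
  obtain ⟨⟨f', y, b, τ⟩, rfl⟩ := quarkEquiv.surjective q
  simp only [thetaMatrix, Equiv.symm_apply_apply, reflIdx_quarkEquiv,
    diracMatrix_quarkEquiv_quarkEquiv]
  by_cases hf : f = f'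
  · subst hf
    simp only [if_true]
    have h := congrFun (congrFun (gamma_conj_wilsonDiracBlock U (mq f) 1 x y a b) σ) τ
    rw [← sum_gamma_star_gamma] at h
    simpa only [Matrix.of_apply] using h
  · simp only [if_neg (Ne.symm hf), if_neg hf, star_zero, mul_zero, zero_mul,
      Finset.sum_const_zero]

end Boltzmann

/-- (W7a) **Reflection symmetry of the time-periodic quark Boltzmann factor under the torus site
reflection `Θ_T`**, for every flavour number, EVERY torus side `L`, every `SU(3)` gauge field and
all bare masses: `Θ_T e^{−ψ̄ D(U) ψ} = e^{−ψ̄ D(Θ'U) ψ}` (Montvay–Münster (4.95)/(4.106),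
`ΘS = S ∘ Θ'`; Osterwalder–Seiler 1978 §2). -/
theorem stub_boltzmannReflect :
    ∀ (Nf L : ℕ) [NeZero L] (U : GaugeConfig 4 L (Matrix.specialUnitaryGroup (Fin 3) ℂ))
      (mq : Fin Nf → ℝ), torusTheta (fermiBoltzmann U mq) = fermiBoltzmann U.negReflect mq := by
  intro Nf L _ U mq
  rw [fermiBoltzmann, fermiBoltzmann, torusTheta_grassmannExp (isNilpotent_quadratic ℂ _),
    torusTheta_quadratic, thetaMatrix_neg, thetaMatrix_diracMatrix]

end Summit.QuantumFields.QCD.Cruxes.LadderCauchyRate.Birth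

end
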